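import Summits.NavierStokesRegularity.NavierStokesRegularity.Theses.CoriolisHead
import Summits.NavierStokesRegularity.NavierStokesRegularity.Theorems.CoriolisHeadCounterRotatingLiouvilleCalculus
import Literature.Analysis.FluidPDE.VorticityCalculus
import Literature.Analysis.FluidPDE.ClassicalSobolevUniqueness
import Literature.Analysis.FluidPDE.VorticityStretching
import Literature.Analysis.FluidPDE.AncientSimilarityVorticity
import Literature.Analysis.FluidPDE.TsaiMaximumPrinciple
import HarnessLib

/-!
# Route CoriolisHead · crux `NoCoRotatingCore` (stmt-NavierStokesRegularity-22676) —
# stub `stub_spinVorticityIdentity`: the spin-vorticity equation of a rotated Leray profile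

Support file of the registered birth skeleton of crux `NoCoRotatingCore` (theorems only;
`--supports stmt-NavierStokesRegularity-22676`; no definitions, no named facts).  It lands the
skeleton's first stub, `stub_spinVorticityIdentity`, by name and verbatim signature.

THE IDENTITY. Let `(U, P)` be a smooth divergence-free solution (`P ∈ C²`) of the rotated Leray
profile system `−νΔU + aU + a DU[y] + (BU − DU[By]) + DU[U] + ∇P = 0` on `ℝ³`, `B` skew
(`⟪Bx, x⟫ = 0`; in `ℝ³` this is `Bx = β × x` with the axial vector `β = ((B e₁)₂, (B e₂)₀, (B e₀)₁)`).
Taking the curl (`rotatedProfile_vorticity_eq`):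

  `νΔω − Dω[U − By + ay] = 2a ω + Bω − DU[ω]`,   `ω = curl U`,

using `curl Δ = Δ curl` (`curl_laplacian`), `curl DU[y] = ω + Dω[y]` (`curl_fderiv_apply_self`),
`curl (BU − DU[By]) = curl[B, DU] − Dω[By]` (`curl_convect`) with the `so(3)` identity
`curl[B, M] = B (curl M)` for skew `B` (`curlCLM_comm_eq_of_skew`), `curl DU[U] = Dω[U] − DU[ω]`
for `div U = 0` (`curl_convect_self_of_isDivFree`), and `curl ∇P = 0` (`curl_gradient_eq_zero_holds`).
Its `β`-component is the stub: the SPIN VORTICITY `ω_β := −Σₗ (B ∂ₗU)ₗ = −tr(B∘DU) = ⟪β, ω⟫`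
(`neg_sum_clm_apply_eq_inner_axial_curlCLM`) obeys

  `νΔω_β − Dω_β[U − By + ay] = 2a ω_β − ⟪β, DU[ω]⟫`,

the Coriolis term dropping out since `⟪β, Bω⟫ = β·(β × ω) = 0` (`inner_axial_clm_apply_eq_zero`);
`⟪β, DU[ω]⟫ = β·Sω` is the strain feed of the co-rotating core named in the route's layer-2 plan.
The tree's `CorkscrewProfile.Birth.stub_rotatedVorticityEq` is the case `ν = 1`, `a = ½`, `B = αJ`
(proved there through the co-rotating frame); here any `ν`, `a` and any skew `B`, by direct
differentiation.

HONEST FRAMING. An exact identity, nothing more: the crux `NoCoRotatingCore` (≡ bounded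
rotated-profile Liouville `X`, see `CoriolisHeadNoCoRotatingCoreReduction`) and Navier–Stokes
regularity are NOT proved here; the skeleton's load-bearing stub `stub_noStrainFedCore` stays open.

References: A. J. Majda, A. L. Bertozzi, *Vorticity and Incompressible Flow* (CUP 2002), §1.1,
§2.1 eq. (2.5) [MajdaBertozziCUP2002]; B. Pineau, V. Vicol, arXiv:2607.09619, (1.8) [PineauVicol2026].
-/

noncomputable section

-- the summit and its single sub-problem share the name (CONVENTIONS §1), as in every Theorems file
set_option linter.dupNamespace false

open scoped BigOperators RealInnerProductSpace Laplacian ContDiff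
open Literature.Analysis.FluidPDE

namespace Summit.NavierStokesRegularity.NavierStokesRegularity.Theorems.CoriolisHead

/-! ### Linear algebra of a skew operator on `ℝ³` -/

section SkewAlgebra

variable (B : EuclideanSpace ℝ (Fin 3) →L[ℝ] EuclideanSpace ℝ (Fin 3))

/-- Entries of a skew operator on `ℝ³`: `(B eⱼ)ᵢ = −(B eᵢ)ⱼ`. -/
theorem clm_single_apply_eq_neg_of_skew (hB : ∀ x, ⟪B x, x⟫ = 0) (i j : Fin 3) :
    B (EuclideanSpace.single j 1) i = -B (EuclideanSpace.single i 1) j := by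
  have h := inner_clm_left_eq_neg_of_skew hB (EuclideanSpace.single j (1 : ℝ))
    (EuclideanSpace.single i (1 : ℝ))
  rw [EuclideanSpace.inner_single_right, EuclideanSpace.inner_single_left] at h
  simpa using h

/-- **`curl [B, M] = B (curl M)`** for a skew `B` on `ℝ³` and any `M`: the axial vector of the
commutator `B∘M − M∘B` is `B` applied to the axial vector `curlCLM M` of `M` (the Lie-algebra
isomorphism `(so(3), [·,·]) ≅ (ℝ³, ×)`; on the symmetric part of `M` both sides vanish). -/
theorem curlCLM_comm_eq_of_skew (hB : ∀ x, ⟪B x, x⟫ = 0)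
    (M : EuclideanSpace ℝ (Fin 3) →L[ℝ] EuclideanSpace ℝ (Fin 3)) :
    curlCLM (B.comp M - M.comp B) = B (curlCLM M) := by
  have h01 := clm_single_apply_eq_neg_of_skew B hB 0 1
  have h02 := clm_single_apply_eq_neg_of_skew B hB 0 2
  have h12 := clm_single_apply_eq_neg_of_skew B hB 1 2
  have hd0 : B (EuclideanSpace.single 0 1) 0 = 0 := by
    have := clm_single_apply_eq_neg_of_skew B hB 0 0; linarith
  have hd1 : B (EuclideanSpace.single 1 1) 1 = 0 := by
    have := clm_single_apply_eq_neg_of_skew B hB 1 1; linarith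
  have hd2 : B (EuclideanSpace.single 2 1) 2 = 0 := by
    have := clm_single_apply_eq_neg_of_skew B hB 2 2; linarith
  have hBM : ∀ j k : Fin 3, B (M (EuclideanSpace.single j 1)) k =
      ∑ m, M (EuclideanSpace.single j 1) m * B (EuclideanSpace.single m 1) k :=
    fun j k => clm_apply_coord B _ k
  have hMB : ∀ j k : Fin 3, M (B (EuclideanSpace.single j 1)) k =
      ∑ m, B (EuclideanSpace.single j 1) m * M (EuclideanSpace.single m 1) k :=
    fun j k => clm_apply_coord M _ k
  have hBc : ∀ k : Fin 3, B (curlCLM M) k =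
      ∑ m, (curlCLM M) m * B (EuclideanSpace.single m 1) k := fun k => clm_apply_coord B _ k
  ext i
  rw [hBc i]
  fin_cases i <;>
    simp [curlCLM_apply, hBM, hMB, Fin.sum_univ_three, h01, h02, h12, hd0, hd1, hd2] <;> ring

/-- The axial vector `β = ((B e₁)₂, (B e₂)₀, (B e₀)₁)` of a skew `B` on `ℝ³` (so that `Bx = β × x`)
is `B`-isotropic: `⟪β, B v⟫ = 0` for every `v` (i.e. `β · (β × v) = 0`). -/
theorem inner_axial_clm_apply_eq_zero (hB : ∀ x, ⟪B x, x⟫ = 0) (v : EuclideanSpace ℝ (Fin 3)) :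
    ⟪(WithLp.toLp 2 ![(B (EuclideanSpace.single 1 1)) 2, (B (EuclideanSpace.single 2 1)) 0,
        (B (EuclideanSpace.single 0 1)) 1] : EuclideanSpace ℝ (Fin 3)), B v⟫ = 0 := by
  have h01 := clm_single_apply_eq_neg_of_skew B hB 0 1
  have h02 := clm_single_apply_eq_neg_of_skew B hB 0 2
  have h12 := clm_single_apply_eq_neg_of_skew B hB 1 2
  have hd0 : B (EuclideanSpace.single 0 1) 0 = 0 := by
    have := clm_single_apply_eq_neg_of_skew B hB 0 0; linarith
  have hd1 : B (EuclideanSpace.single 1 1) 1 = 0 := by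
    have := clm_single_apply_eq_neg_of_skew B hB 1 1; linarith
  have hd2 : B (EuclideanSpace.single 2 1) 2 = 0 := by
    have := clm_single_apply_eq_neg_of_skew B hB 2 2; linarith
  have hBv : ∀ k : Fin 3, B v k = ∑ m, v m * B (EuclideanSpace.single m 1) k :=
    fun k => clm_apply_coord B v k
  simp [PiLp.inner_apply, Fin.sum_univ_three, hBv, h01, h02, h12, hd0, hd1, hd2]
  ring

/-- The Coriolis defect in axial form: for a skew `B` on `ℝ³` with axial vector
`β = ((B e₁)₂, (B e₂)₀, (B e₀)₁)` and any `M`, `−Σₗ (B (M eₗ))ₗ = −tr(B∘M) = ⟪β, curlCLM M⟫`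
(for `M = DU(y)`: `−tr(B∘DU) = β · curl U`, the spin vorticity). -/
theorem neg_sum_clm_apply_eq_inner_axial_curlCLM (hB : ∀ x, ⟪B x, x⟫ = 0)
    (M : EuclideanSpace ℝ (Fin 3) →L[ℝ] EuclideanSpace ℝ (Fin 3)) :
    -(∑ l, (B (M (EuclideanSpace.single l 1))) l) =
      ⟪(WithLp.toLp 2 ![(B (EuclideanSpace.single 1 1)) 2, (B (EuclideanSpace.single 2 1)) 0,
        (B (EuclideanSpace.single 0 1)) 1] : EuclideanSpace ℝ (Fin 3)), curlCLM M⟫ := by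
  have h01 := clm_single_apply_eq_neg_of_skew B hB 0 1
  have h02 := clm_single_apply_eq_neg_of_skew B hB 0 2
  have h12 := clm_single_apply_eq_neg_of_skew B hB 1 2
  have hd0 : B (EuclideanSpace.single 0 1) 0 = 0 := by
    have := clm_single_apply_eq_neg_of_skew B hB 0 0; linarith
  have hd1 : B (EuclideanSpace.single 1 1) 1 = 0 := by
    have := clm_single_apply_eq_neg_of_skew B hB 1 1; linarith
  have hd2 : B (EuclideanSpace.single 2 1) 2 = 0 := by
    have := clm_single_apply_eq_neg_of_skew B hB 2 2; linarith
  have hBM : ∀ j k : Fin 3, B (M (EuclideanSpace.single j 1)) k =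
      ∑ m, M (EuclideanSpace.single j 1) m * B (EuclideanSpace.single m 1) k :=
    fun j k => clm_apply_coord B _ k
  simp [PiLp.inner_apply, curlCLM_apply, Fin.sum_univ_three, hBM, h01, h02, h12, hd0, hd1, hd2]
  ring

end SkewAlgebra

/-! ### The vorticity equation of a rotated Leray profile -/

section Vorticity

variable {ν a : ℝ} {B : EuclideanSpace ℝ (Fin 3) →L[ℝ] EuclideanSpace ℝ (Fin 3)}
  {U : EuclideanSpace ℝ (Fin 3) → EuclideanSpace ℝ (Fin 3)} {P : EuclideanSpace ℝ (Fin 3) → ℝ}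

/-- **The vorticity equation of a rotated Leray profile, any skew frame rate.** For a smooth
divergence-free solution `(U, P)` (`P ∈ C²`) of
`−νΔU + aU + a DU[y] + (BU − DU[By]) + DU[U] + ∇P = 0` with `B` skew, the vorticity `ω = curl U`
solves `νΔω − Dω[U − By + ay] = 2a ω + Bω − DU[ω]`: the curl of the system, using
`curl Δ = Δ curl`, `curl (DU[y]) = ω + Dω[y]`, `curl (BU − DU[By]) = curl[B, DU] − Dω[By] = Bω − Dω[By]`
(`curlCLM_comm_eq_of_skew`), `curl DU[U] = Dω[U] − DU[ω]` (`div U = 0`) and `curl ∇P = 0`.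
[cite: MajdaBertozziCUP2002, §1.1 (vector identities) and §2.1 eq. (2.5)] -/
theorem rotatedProfile_vorticity_eq (hU : ContDiff ℝ (⊤ : ℕ∞) U) (hP : ContDiff ℝ 2 P)
    (hB : ∀ x, ⟪B x, x⟫ = 0) (hdiv : VectorCalculus.IsDivFree U)
    (heq : ∀ y, -(ν • Laplacian.laplacian U y) + a • U y + a • fderiv ℝ U y y
      + (B (U y) - fderiv ℝ U y (B y)) + convect U U y + gradient P y = 0)
    (y : EuclideanSpace ℝ (Fin 3)) :
    ν • Laplacian.laplacian (curl U) y - fderiv ℝ (curl U) y (U y - B y + a • y)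
      = (2 * a) • curl U y + B (curl U y) - fderiv ℝ U y (curl U y) := by
  -- regularity bookkeeping
  have hU2 : ContDiff ℝ 2 U := hU.of_le (by norm_cast)
  have hU3 : ContDiff ℝ 3 U := hU.of_le (by norm_cast)
  have dU : DifferentiableAt ℝ U y := (hU.differentiable (by simp)) y
  have dDU : DifferentiableAt ℝ (fderiv ℝ U) y :=
    ((hU.fderiv_right (m := 1) (by norm_cast)).differentiable one_ne_zero) y
  have dΔ : DifferentiableAt ℝ (Laplacian.laplacian U) y :=
    ((contDiff_laplacian (n := 1) (hU.of_le (by norm_cast))).differentiable one_ne_zero) y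
  have d1 : DifferentiableAt ℝ (fun z => ν • Laplacian.laplacian U z) y := dΔ.const_smul ν
  have d1' : DifferentiableAt ℝ (fun z => -(ν • Laplacian.laplacian U z)) y := d1.neg
  have d2 : DifferentiableAt ℝ (fun z => a • U z) y := dU.const_smul a
  have dyy : DifferentiableAt ℝ (fun z => fderiv ℝ U z z) y := dDU.clm_apply differentiableAt_id
  have d3 : DifferentiableAt ℝ (fun z => a • fderiv ℝ U z z) y := dyy.const_smul a
  have hBU : HasFDerivAt (fun z => B (U z)) (B.comp (fderiv ℝ U y)) y :=
    B.hasFDerivAt.comp y dU.hasFDerivAt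
  have dBU : DifferentiableAt ℝ (fun z => B (U z)) y := hBU.differentiableAt
  have dUB : DifferentiableAt ℝ (fun z => fderiv ℝ U z (B z)) y :=
    dDU.clm_apply (B.differentiable.differentiableAt)
  have d4 : DifferentiableAt ℝ (fun z => B (U z) - fderiv ℝ U z (B z)) y := dBU.sub dUB
  have d5 : DifferentiableAt ℝ (convect U U) y := by
    show DifferentiableAt ℝ (fun z => fderiv ℝ U z (U z)) y
    exact dDU.clm_apply dU
  have d6 : DifferentiableAt ℝ (gradient P) y :=
    ((InnerProductSpace.toDual ℝ (EuclideanSpace ℝ (Fin 3))).symm.differentiable.comp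
      ((hP.fderiv_right (m := 1) le_rfl).differentiable one_ne_zero)) y
  -- curl of the system
  have hfun : (fun z => -(ν • Laplacian.laplacian U z) + a • U z + a • fderiv ℝ U z z
      + (B (U z) - fderiv ℝ U z (B z)) + convect U U z + gradient P z) = fun _ => 0 := funext heq
  have h0 : curl (fun z => -(ν • Laplacian.laplacian U z) + a • U z + a • fderiv ℝ U z z
      + (B (U z) - fderiv ℝ U z (B z)) + convect U U z + gradient P z) y = 0 := by
    rw [hfun]; exact curl_fun_zero y
  have d12 : DifferentiableAt ℝ (fun z => -(ν • Laplacian.laplacian U z) + a • U z) y := d1'.add d2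
  have d123 : DifferentiableAt ℝ (fun z => -(ν • Laplacian.laplacian U z) + a • U z
      + a • fderiv ℝ U z z) y := d12.add d3
  have d1234 : DifferentiableAt ℝ (fun z => -(ν • Laplacian.laplacian U z) + a • U z
      + a • fderiv ℝ U z z + (B (U z) - fderiv ℝ U z (B z))) y := d123.add d4
  have d12345 : DifferentiableAt ℝ (fun z => -(ν • Laplacian.laplacian U z) + a • U z
      + a • fderiv ℝ U z z + (B (U z) - fderiv ℝ U z (B z)) + convect U U z) y := d1234.add d5
  rw [curl_add d12345 d6, curl_add d1234 d5, curl_add d123 d4, curl_add d12 d3,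
    curl_add d1' d2] at h0
  -- the six curls
  have c1 : curl (fun z => -(ν • Laplacian.laplacian U z)) y
      = -(ν • Laplacian.laplacian (curl U) y) := by
    rw [curl_neg, curl_const_smul dΔ, curl_laplacian hU3]
  have c2 : curl (fun z => a • U z) y = a • curl U y := curl_const_smul dU a
  have c3 : curl (fun z => a • fderiv ℝ U z z) y = a • (curl U y + fderiv ℝ (curl U) y y) := by
    rw [curl_const_smul dyy, curl_fderiv_apply_self hU2]
  have c4 : curl (fun z => B (U z) - fderiv ℝ U z (B z)) y
      = B (curl U y) - fderiv ℝ (curl U) y (B y) := by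
    rw [curl_sub dBU dUB]
    have c41 : curl (fun z => B (U z)) y = curlCLM (B.comp (fderiv ℝ U y)) := by
      rw [curl_eq_curlCLM, hBU.fderiv]
    have c42 : curl (fun z => fderiv ℝ U z (B z)) y
        = fderiv ℝ (curl U) y (B y) + curlCLM ((fderiv ℝ U y).comp B) := by
      have : (fun z => fderiv ℝ U z (B z)) = convect (⇑B) U := rfl
      rw [this, curl_convect (B.contDiff) hU2 y, B.fderiv, convect_apply]
    have hc := curlCLM_comm_eq_of_skew B hB (fderiv ℝ U y)
    rw [map_sub, ← curl_eq_curlCLM] at hc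
    rw [c41, c42, ← hc]
    abel
  have c5 : curl (convect U U) y = fderiv ℝ (curl U) y (U y) - fderiv ℝ U y (curl U y) := by
    rw [curl_convect_self_of_isDivFree hU2 hdiv, convect_apply, convect_apply]
  have c6 : curl (gradient P) y = 0 := curl_gradient_eq_zero_holds P hP y
  rw [c1, c2, c3, c4, c5, c6] at h0
  rw [map_add, map_sub, map_smul]
  linear_combination (norm := module) -h0

end Vorticity

/-! ### The drift operator on a fixed component of the vorticity -/

section Drift

variable {ν a : ℝ}

/-- The drift–Laplace operator `L f = νΔf − Df[V + a y]` on a fixed component `f = ⟪β, ω⟫` of a `C²`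
field: `L ⟪β, ω⟫ (y) = ⟪β, νΔω(y) − Dω(y)[V(y) + a y]⟫` (linear maps commute with `Δ` and `D`). -/
theorem driftOp_inner_const_apply {W V : EuclideanSpace ℝ (Fin 3) → EuclideanSpace ℝ (Fin 3)}
    (hW : ContDiff ℝ 2 W) (β y : EuclideanSpace ℝ (Fin 3)) :
    driftOp ν a V (fun z => ⟪β, W z⟫) y
      = ⟪β, ν • Laplacian.laplacian W y - fderiv ℝ W y (V y + a • y)⟫ := by
  have hcomp : (fun z => ⟪β, W z⟫) = ⇑(innerSL ℝ β) ∘ W := by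
    funext z; simp
  have hd : HasFDerivAt (⇑(innerSL ℝ β) ∘ W) ((innerSL ℝ β).comp (fderiv ℝ W y)) y :=
    (innerSL ℝ β).hasFDerivAt.comp y ((hW.differentiable (by norm_num)) y).hasFDerivAt
  rw [driftOp, hcomp, hW.contDiffAt.laplacian_CLM_comp_left, hd.fderiv]
  simp only [Function.comp_apply, ContinuousLinearMap.comp_apply, innerSL_apply_apply,
    inner_sub_right, inner_smul_right]

end Drift

/-! ### The registered stub -/

/-- **Registered stub `stub_spinVorticityIdentity`** of the skeleton of crux `NoCoRotatingCore`
(stmt-NavierStokesRegularity-22676, birth line): the SPIN-VORTICITY EQUATION of a rotated Leray profile.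
For a smooth divergence-free solution `(U, P)` of `−νΔU + aU + a DU[y] + (BU − DU[By]) + DU[U] + ∇P = 0`
with `B` skew and axial vector `β = ((B e₁)₂, (B e₂)₀, (B e₀)₁)` (`Bx = β × x`), the spin vorticity
`ω_β := −Σₗ (B ∂ₗU)ₗ = −tr(B∘DU) = ⟪β, curl U⟫` satisfies
`νΔω_β − Dω_β[U − By + ay] = 2a ω_β − ⟪β, DU[curl U]⟫` — the `β`-component of the vorticity
equation `νΔω − Dω[U − By + ay] = 2aω + Bω − DU[ω]` (`rotatedProfile_vorticity_eq`), the Coriolis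
term dropping out because `⟪β, Bω⟫ = β·(β × ω) = 0`; `⟪β, DU[ω]⟫ = β·Sω` is the strain feed of the
co-rotating core. [cite: MajdaBertozziCUP2002, §1.1 (vector identities) and §2.1 eq. (2.5)] -/
theorem stub_spinVorticityIdentity : ∀ (ν a : ℝ) (B : EuclideanSpace ℝ (Fin 3) →L[ℝ] EuclideanSpace ℝ (Fin 3)) (U : EuclideanSpace ℝ (Fin 3) → EuclideanSpace ℝ (Fin 3)) (P : EuclideanSpace ℝ (Fin 3) → ℝ), ContDiff ℝ (⊤ : ℕ∞) U → ContDiff ℝ 2 P → (∀ x, inner ℝ (B x) x = 0) → Literature.Analysis.FluidPDE.VectorCalculus.IsDivFree U → (∀ y, -(ν • Laplacian.laplacian U y) + a • U y + a • fderiv ℝ U y y + (B (U y) - fderiv ℝ U y (B y)) + Literature.Analysis.FluidPDE.convect U U y + gradient P y = 0) → ∀ y, Literature.Analysis.FluidPDE.driftOp ν a (fun z => U z - B z) (fun z => -(∑ l, (B (fderiv ℝ U z (EuclideanSpace.single l 1))) l)) y = 2 * a * ((fun z => -(∑ l, (B (fderiv ℝ U z (EuclideanSpace.single l 1))) l)) y)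 - inner ℝ (WithLp.toLp 2 ![(B (EuclideanSpace.single 1 1)) 2, (B (EuclideanSpace.single 2 1)) 0, (B (EuclideanSpace.single 0 1)) 1] : EuclideanSpace ℝ (Fin 3)) (fderiv ℝ U y (Literature.Analysis.FluidPDE.curl U y)) := by
  intro ν a B U P hU hP hB hdiv heq y
  have hU3 : ContDiff ℝ 3 U := hU.of_le (by norm_cast)
  have hω2 : ContDiff ℝ 2 (curl U) := contDiff_curl (n := 2) (by exact_mod_cast hU3)
  -- the spin vorticity is the `β`-component of the vorticity
  have hspin : (fun z => -(∑ l, (B (fderiv ℝ U z (EuclideanSpace.single l 1))) l))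
      = fun z => ⟪(WithLp.toLp 2 ![(B (EuclideanSpace.single 1 1)) 2, (B (EuclideanSpace.single 2 1)) 0,
          (B (EuclideanSpace.single 0 1)) 1] : EuclideanSpace ℝ (Fin 3)), curl U z⟫ :=
    funext fun z => by
      rw [curl_eq_curlCLM]; exact neg_sum_clm_apply_eq_inner_axial_curlCLM B hB _
  rw [hspin]
  simp only []
  rw [driftOp_inner_const_apply hω2, rotatedProfile_vorticity_eq hU hP hB hdiv heq y,
    inner_sub_right, inner_add_right, inner_axial_clm_apply_eq_zero B hB, inner_smul_right]
  ring

end Summit.NavierStokesRegularity.NavierStokesRegularity.Theorems.CoriolisHead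

end
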